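import Literature.GroupTheory.CombinatorialGroupTheory.RandomSclFreeGroupTokenCombs
import HarnessLib

/-!
# Random rigidity of scl (Calegari–Walker 2013): proofs, part 28 — combs in a token structure:
the averaging identity and the bad-comb bookkeeping (CW §4.7, Lemma 4.12)

D. Calegari, A. Walker, *Random rigidity in the free group*, Geom. Topol. 17 (2013)
[CalegariWalker2013], §4.7: in a trivalent fatgraph every edge lies in exactly `4d + 2` combs of
complexity `d`, so the total comb length is `(2d+1)` times the total edge length. In the token
language of part 27 (successor `S`, involution `P`): the comb at `p` has length
`L(p) = Σ_{i ≤ d} len (p+i) + Σ_{1 ≤ e ≤ d} len (S (P (p+e)))`, and since shifts, `P` and `S` are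
bijections of the token set, `Σ_p L(p) = (2d+1) · Σ_p len p = (2d+1) N`.

* **`sum_range_comp_eq`** — reindexing a sum over `range Tn` along a bijection.
* **`sum_combLength_eq`** — `Σ_p L(p) = (2d+1) N`.
* **`sum_combLength_long_eq`** — the long tokens contribute `(2d+1) Σ_{long} len` in total.
* **`token_disjoint`**, **`card_filter_hit_le`** — tokens are disjoint; those meeting the period
  boundary number `≤ N / n′`.
* **`hit_of_arc_wrap`**, **`hit_of_block_wrap`** — a wrapping arc/block meets the period boundary.
* **`token_comb_inequality`** — the deterministic comb inequality
  `(2d+1)N ≤ Tn·Lthr + #bad·(2d+1)ℓmax + (2d+1)Σ_{long} len`.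
-/

noncomputable section

namespace Literature.GroupTheory.CombinatorialGroupTheory

section TokenAveraging

open Finset

open scoped Classical

/-- Reindexing a sum over `range Tn` along a map with a two-sided inverse on `range Tn`.
[folklore] -/
theorem sum_range_comp_eq {β : Type*} [AddCommMonoid β] {Tn : ℕ} (h : ℕ → β) (f g : ℕ → ℕ)
    (hf : ∀ p, p < Tn → f p < Tn) (hg : ∀ p, p < Tn → g p < Tn)
    (hgf : ∀ p, p < Tn → g (f p) = p) (hfg : ∀ p, p < Tn → f (g p) = p) :
    ∑ p ∈ Finset.range Tn, h (f p) = ∑ p ∈ Finset.range Tn, h p := by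
  apply Finset.sum_nbij' f g
  · intro p hp; rw [Finset.mem_range] at hp ⊢; exact hf p hp
  · intro p hp; rw [Finset.mem_range] at hp ⊢; exact hg p hp
  · intro p hp; rw [Finset.mem_range] at hp; exact hgf p hp
  · intro p hp; rw [Finset.mem_range] at hp; exact hfg p hp
  · intro p _; rfl

/-- The shift `p ↦ (p + i) % Tn` is a bijection of `range Tn`. [folklore] -/
theorem sum_range_shift_eq {β : Type*} [AddCommMonoid β] {Tn : ℕ} (h : ℕ → β) (i : ℕ) :
    ∑ p ∈ Finset.range Tn, h ((p + i) % Tn) = ∑ p ∈ Finset.range Tn, h p := by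
  rcases Nat.eq_zero_or_pos Tn with hT | hT
  · subst hT; simp
  apply sum_range_comp_eq h (fun p => (p + i) % Tn) (fun p => (p + (Tn - i % Tn)) % Tn)
  · intro p _; exact Nat.mod_lt _ hT
  · intro p _; exact Nat.mod_lt _ hT
  · intro p hp
    rw [Nat.mod_add_mod]
    have h1 : i % Tn < Tn := Nat.mod_lt _ hT
    have h2 : i % Tn ≤ i := Nat.mod_le _ _
    have h3 : i - i % Tn = (i / Tn) * Tn := by have := Nat.div_add_mod i Tn; rw [Nat.mul_comm]; omega
    rw [show p + i + (Tn - i % Tn) = p + (i - i % Tn) + Tn by omega, Nat.add_mod_right, h3,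
      Nat.add_mul_mod_self_right, Nat.mod_eq_of_lt hp]
  · intro p hp
    rw [Nat.mod_add_mod]
    have h1 : i % Tn < Tn := Nat.mod_lt _ hT
    have h2 : i % Tn ≤ i := Nat.mod_le _ _
    have h3 : i - i % Tn = (i / Tn) * Tn := by have := Nat.div_add_mod i Tn; rw [Nat.mul_comm]; omega
    rw [show p + (Tn - i % Tn) + i = p + (i - i % Tn) + Tn by omega, Nat.add_mod_right, h3,
      Nat.add_mul_mod_self_right, Nat.mod_eq_of_lt hp]

/-- An involution `P` of `range Tn` reindexes sums. [folklore] -/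
theorem sum_range_invol_eq {β : Type*} [AddCommMonoid β] {Tn : ℕ} (h : ℕ → β) (P : ℕ → ℕ)
    (hP : ∀ p, p < Tn → P p < Tn ∧ P (P p) = p) :
    ∑ p ∈ Finset.range Tn, h (P p) = ∑ p ∈ Finset.range Tn, h p :=
  sum_range_comp_eq h P P (fun p hp => (hP p hp).1) (fun p hp => (hP p hp).1)
    (fun p hp => (hP p hp).2) (fun p hp => (hP p hp).2)

/-- **The averaging identity (CW §4.7: every edge lies in `4d+2` combs).** In a token structure
with `Σ_p len p = N` and an involution `P` of the tokens,
`Σ_{p < Tn} L(p) = (2d+1) N` where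
`L(p) = Σ_{i<d+1} len((p+i) % Tn) + Σ_{e<d+2} [1 ≤ e ≤ d] len((P((p+e) % Tn) + 1) % Tn)`.
[cite: CalegariWalker2013, §4.7] -/
theorem sum_combLength_eq {Tn N d : ℕ} (len P : ℕ → ℕ)
    (hP : ∀ p, p < Tn → P p < Tn ∧ P (P p) = p) (hsum : ∑ p ∈ Finset.range Tn, len p = N) :
    ∑ p ∈ Finset.range Tn, ((∑ i ∈ Finset.range (d + 1), len ((p + i) % Tn)) +
      ∑ e ∈ Finset.range (d + 2),
        (if 1 ≤ e ∧ e ≤ d then len ((P ((p + e) % Tn) + 1) % Tn) else 0)) = (2 * d + 1) * N := by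
  rw [Finset.sum_add_distrib, Finset.sum_comm, Finset.sum_comm (s := Finset.range Tn)]
  have h1 : ∀ i ∈ Finset.range (d + 1), ∑ p ∈ Finset.range Tn, len ((p + i) % Tn) = N := by
    intro i _
    rw [sum_range_shift_eq len i, hsum]
  have h2 : ∀ e ∈ Finset.range (d + 2), ∑ p ∈ Finset.range Tn,
      (if 1 ≤ e ∧ e ≤ d then len ((P ((p + e) % Tn) + 1) % Tn) else 0) =
        if 1 ≤ e ∧ e ≤ d then N else 0 := by
    intro e _
    split_ifs with h
    · rw [sum_range_shift_eq (fun x => len ((P x + 1) % Tn)) e,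
        sum_range_invol_eq (fun x => len ((x + 1) % Tn)) P hP, sum_range_shift_eq len 1, hsum]
    · simp
  rw [Finset.sum_congr rfl h1, Finset.sum_congr rfl h2, Finset.sum_const, Finset.card_range,
    smul_eq_mul]
  have h3 : ∑ e ∈ Finset.range (d + 2), (if 1 ≤ e ∧ e ≤ d then N else 0) = d * N := by
    rw [Finset.sum_ite, Finset.sum_const_zero, add_zero, Finset.sum_const, smul_eq_mul]
    congr 1
    have : (Finset.range (d + 2)).filter (fun e => 1 ≤ e ∧ e ≤ d) = Finset.Icc 1 d := by
      ext e; simp [Finset.mem_filter, Finset.mem_Icc]; omega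
    rw [this, Nat.card_Icc]
    omega
  rw [h3]
  ring

/-- **Long tokens contribute little to the total comb length.** For a threshold `ℓmax`, the sum
over all combs of the lengths of their LONG tokens (length `> ℓmax`, among the `2d+1` tokens of
`L(p)`) is `(2d+1) · Σ_{long} len`. [cite: CalegariWalker2013, §4.7 (long edges are negligible)] -/
theorem sum_combLength_long_eq {Tn d ℓmax : ℕ} (len P : ℕ → ℕ)
    (hP : ∀ p, p < Tn → P p < Tn ∧ P (P p) = p) :
    ∑ p ∈ Finset.range Tn, ((∑ i ∈ Finset.range (d + 1),
        (if ℓmax < len ((p + i) % Tn) then len ((p + i) % Tn) else 0)) +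
      ∑ e ∈ Finset.range (d + 2), (if 1 ≤ e ∧ e ≤ d then
        (if ℓmax < len ((P ((p + e) % Tn) + 1) % Tn) then len ((P ((p + e) % Tn) + 1) % Tn) else 0)
          else 0)) =
      (2 * d + 1) * ∑ p ∈ Finset.range Tn, (if ℓmax < len p then len p else 0) := by
  set F : ℕ → ℕ := fun x => if ℓmax < len x then len x else 0 with hF
  have hmain := sum_combLength_eq (d := d) F P hP rfl
  -- `sum_combLength_eq` with `len := F`
  simp only [hF] at hmain
  convert hmain using 2

/-- **Tokens are disjoint.** In a token structure (starts `< N`, consecutive, total length `N`),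
distinct tokens occupy disjoint sets of positions of the cyclic word. [folklore] -/
theorem token_disjoint {Tn N : ℕ} (start len : ℕ → ℕ) (hstart : ∀ p, p < Tn → start p < N)
    (hcons : ∀ p, p < Tn → start ((p + 1) % Tn) = (start p + len p) % N)
    (hsum : ∑ p ∈ Finset.range Tn, len p = N) {T T' j j' : ℕ} (hT : T < Tn) (hT' : T' < Tn)
    (hne : T ≠ T') (hj : j < len T) (hj' : j' < len T') :
    (start T + j) % N ≠ (start T' + j') % N := by
  have hTn : 0 < Tn := by omega
  have hN : 0 < N := by have := hstart T hT; omega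
  -- `start T ≡ start 0 + Pref T`
  have key : ∀ U, U < Tn → start U = (start 0 + ∑ i ∈ Finset.range U, len i) % N := by
    intro U hU
    have h := start_add_mod start len hstart hcons 0 hTn U
    rw [Nat.zero_add, Nat.mod_eq_of_lt hU] at h
    rw [h]
    congr 2
    apply Finset.sum_congr rfl
    intro i hi
    rw [Finset.mem_range] at hi
    rw [Nat.zero_add, Nat.mod_eq_of_lt (by omega)]
  have hpre : ∀ U, U < Tn → (∑ i ∈ Finset.range U, len i) + len U ≤ N := by
    intro U hU
    rw [← hsum]
    exact prefixSum_add_le len hU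
  intro heq
  rw [key T hT, key T' hT', Nat.mod_add_mod, Nat.mod_add_mod, add_assoc, add_assoc,
    Nat.add_mod, Nat.add_mod (start 0)] at heq
  have h1 : ((∑ i ∈ Finset.range T, len i) + j) % N = (∑ i ∈ Finset.range T, len i) + j :=
    Nat.mod_eq_of_lt (by have := hpre T hT; omega)
  have h2 : ((∑ i ∈ Finset.range T', len i) + j') % N = (∑ i ∈ Finset.range T', len i) + j' :=
    Nat.mod_eq_of_lt (by have := hpre T' hT'; omega)
  rw [h1, h2] at heq
  -- adding `start 0 % N` modulo `N` is injective on `[0, N)`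
  have hinj : ∀ a b, a < N → b < N → (start 0 % N + a) % N = (start 0 % N + b) % N → a = b := by
    intro a b ha hb h
    have := Nat.ModEq.add_left_cancel' (start 0 % N) h
    rwa [Nat.ModEq, Nat.mod_eq_of_lt ha, Nat.mod_eq_of_lt hb] at this
  have h3 := hinj _ _ (by have := hpre T hT; omega) (by have := hpre T' hT'; omega) heq
  -- but the prefix intervals of distinct tokens are disjoint
  rcases Nat.lt_or_gt_of_ne hne with h | h
  · have := prefixSum_add_le len h; omega
  · have := prefixSum_add_le len h; omega

/-- **Tokens meeting the period boundary are few.** The tokens containing a position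
`≡ n′ − 1 (mod n′)` number at most `N / n′` (tokens are disjoint). [folklore] -/
theorem card_filter_hit_le {Tn N n' : ℕ} (hn' : 0 < n') (hNn : n' ∣ N) (start len : ℕ → ℕ)
    (hstart : ∀ p, p < Tn → start p < N)
    (hcons : ∀ p, p < Tn → start ((p + 1) % Tn) = (start p + len p) % N)
    (hsum : ∑ p ∈ Finset.range Tn, len p = N) :
    ((Finset.range Tn).filter fun T => ∃ j, j < len T ∧ (start T + j) % N % n' = n' - 1).card ≤
      N / n' := by
  have hN0 : ∀ T, T < Tn → 0 < N := fun T hT => by have := hstart T hT; omega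
  set H := (Finset.range Tn).filter fun T => ∃ j, j < len T ∧ (start T + j) % N % n' = n' - 1 with hH
  -- choose a witness position for every hit token
  have hex : ∀ T, T ∈ H → ∃ x, x < N ∧ x % n' = n' - 1 ∧ ∃ j, j < len T ∧ (start T + j) % N = x := by
    intro T hT
    rw [hH, Finset.mem_filter, Finset.mem_range] at hT
    obtain ⟨hT, j, hj, hx⟩ := hT
    exact ⟨(start T + j) % N, Nat.mod_lt _ (hN0 T hT), hx, j, hj, rfl⟩
  choose! wit hwit using hex
  -- the witness map is injective (tokens are disjoint) into the positions `≡ n' - 1`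
  have hinj : Set.InjOn wit (H : Set ℕ) := by
    intro T hT T' hT' heq
    by_contra hne
    obtain ⟨_, _, j, hj, hxj⟩ := hwit T hT
    obtain ⟨_, _, j', hj', hxj'⟩ := hwit T' hT'
    have hT1 : T < Tn := by
      have := hT; rw [Finset.mem_coe, hH, Finset.mem_filter, Finset.mem_range] at this; exact this.1
    have hT2 : T' < Tn := by
      have := hT'; rw [Finset.mem_coe, hH, Finset.mem_filter, Finset.mem_range] at this; exact this.1
    apply token_disjoint start len hstart hcons hsum hT1 hT2 hne hj hj'
    rw [hxj, hxj', heq]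
  have hmaps : ∀ T ∈ H, wit T ∈ (Finset.range N).filter fun x => x % n' = n' - 1 := by
    intro T hT
    obtain ⟨hx, hxm, _⟩ := hwit T hT
    rw [Finset.mem_filter, Finset.mem_range]
    exact ⟨hx, hxm⟩
  have h1 := Finset.card_le_card_of_injOn wit hmaps hinj
  refine h1.trans ?_
  -- `#{x < N : x % n' = n' - 1} ≤ N / n'` via `x ↦ x / n'`
  have hinj2 : Set.InjOn (fun x => x / n') (((Finset.range N).filter fun x => x % n' = n' - 1) : Set ℕ) := by
    intro x hx y hy heq
    rw [Finset.coe_filter] at hx hy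
    have ex := Nat.div_add_mod x n'
    have ey := Nat.div_add_mod y n'
    simp only at heq
    rw [hx.2] at ex; rw [hy.2] at ey
    rw [← ex, ← ey, heq]
  have hmaps2 : ∀ x ∈ (Finset.range N).filter (fun x => x % n' = n' - 1), x / n' ∈ Finset.range (N / n') := by
    intro x hx
    rw [Finset.mem_filter, Finset.mem_range] at hx
    rw [Finset.mem_range]
    obtain ⟨c, hc⟩ := hNn
    rw [hc, Nat.mul_div_cancel_left _ hn']
    rw [hc] at hx
    exact Nat.div_lt_of_lt_mul hx.1
  have h2 := Finset.card_le_card_of_injOn _ hmaps2 hinj2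
  rw [Finset.card_range] at h2
  exact h2

/-- **A wrapping arc meets the period boundary.** If the arc of the comb at `p` does not fit in
one period (`start p % n′ + Σ len > n′`), one of its tokens contains a position `≡ n′ − 1`.
[folklore] -/
theorem hit_of_arc_wrap {Tn N n' d : ℕ} (hn' : 0 < n') (hNn : n' ∣ N) (start len : ℕ → ℕ)
    (hstart : ∀ p, p < Tn → start p < N)
    (hcons : ∀ p, p < Tn → start ((p + 1) % Tn) = (start p + len p) % N) (p : ℕ) (hp : p < Tn)
    (h : n' < start p % n' + ∑ i ∈ Finset.range (d + 1), len ((p + i) % Tn)) :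
    ∃ i, i < d + 1 ∧ ∃ j, j < len ((p + i) % Tn) ∧ (start ((p + i) % Tn) + j) % N % n' = n' - 1 := by
  have hsp : start p % n' < n' := Nat.mod_lt _ hn'
  obtain ⟨i, hi, h1, h2⟩ := exists_lt_prefixSum (fun i => len ((p + i) % Tn)) (d + 1)
    (n' - 1 - start p % n') (by omega)
  refine ⟨i, hi, n' - 1 - start p % n' - ∑ i' ∈ Finset.range i, len ((p + i') % Tn), by omega, ?_⟩
  rw [Nat.mod_mod_of_dvd _ hNn]
  have hq : Nat.ModEq n' (start ((p + i) % Tn))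
      (start p + ∑ i' ∈ Finset.range i, len ((p + i') % Tn)) := by
    show _ % n' = _ % n'
    rw [start_add_mod start len hstart hcons p hp i, Nat.mod_mod_of_dvd _ hNn]
  rw [hq.add_right _, add_assoc, Nat.add_mod,
    show (∑ i' ∈ Finset.range i, len ((p + i') % Tn)) +
      (n' - 1 - start p % n' - ∑ i' ∈ Finset.range i, len ((p + i') % Tn)) = n' - 1 - start p % n' by omega,
    Nat.mod_eq_of_lt (show n' - 1 - start p % n' < n' by omega),
    show start p % n' + (n' - 1 - start p % n') = n' - 1 by omega, Nat.mod_eq_of_lt (by omega)]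

/-- **A wrapping block meets the period boundary.** If the block `S⁻¹ x, x, S x` does not fit in
one period, one of its three tokens contains a position `≡ n′ − 1`. [folklore] -/
theorem hit_of_block_wrap {Tn N n' : ℕ} (hn' : 0 < n') (hNn : n' ∣ N) (start len : ℕ → ℕ)
    (hcons : ∀ p, p < Tn → start ((p + 1) % Tn) = (start p + len p) % N) (x : ℕ) (hx : x < Tn)
    (h : n' < start ((x + Tn - 1) % Tn) % n' +
      (len ((x + Tn - 1) % Tn) + len x + len ((x + 1) % Tn))) :
    (∃ j, j < len ((x + Tn - 1) % Tn) ∧ (start ((x + Tn - 1) % Tn) + j) % N % n' = n' - 1) ∨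
    (∃ j, j < len x ∧ (start x + j) % N % n' = n' - 1) ∨
    (∃ j, j < len ((x + 1) % Tn) ∧ (start ((x + 1) % Tn) + j) % N % n' = n' - 1) := by
  have hTn : 0 < Tn := by omega
  set B := (x + Tn - 1) % Tn with hB
  set C := (x + 1) % Tn with hC
  have hBlt : B < Tn := Nat.mod_lt _ hTn
  have hsB : start B % n' < n' := Nat.mod_lt _ hn'
  set y := n' - 1 - start B % n' with hy
  -- `start x ≡ start B + len B`, `start C ≡ start x + len x`
  have hxB : Nat.ModEq n' (start x) (start B + len B) := by
    show _ % n' = _ % n'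
    have h1 := hcons B hBlt
    rw [show (B + 1) % Tn = x from succ_pred_mod x hx] at h1
    rw [h1, Nat.mod_mod_of_dvd _ hNn]
  have hCx : Nat.ModEq n' (start C) (start x + len x) := by
    show _ % n' = _ % n'
    rw [hC, hcons x hx, Nat.mod_mod_of_dvd _ hNn]
  by_cases h1 : y < len B
  · left
    refine ⟨y, h1, ?_⟩
    rw [Nat.mod_mod_of_dvd _ hNn, add_mod_eq_of_lt (by omega)]
    omega
  by_cases h2 : y < len B + len x
  · right; left
    refine ⟨y - len B, by omega, ?_⟩
    rw [Nat.mod_mod_of_dvd _ hNn, (hxB.add_right _), add_assoc, add_mod_eq_of_lt (by omega)]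
    omega
  · right; right
    refine ⟨y - len B - len x, by omega, ?_⟩
    rw [Nat.mod_mod_of_dvd _ hNn, ((hCx.trans (hxB.add_right _)).add_right _), add_assoc, add_assoc,
      add_mod_eq_of_lt (by omega)]
    omega

/-- Reindexing a filter-count over `range Tn` along a map with a two-sided inverse. [folklore] -/
theorem card_filter_comp_eq {Tn : ℕ} (Q : ℕ → Prop) [DecidablePred Q] (f g : ℕ → ℕ)
    [DecidablePred fun p => Q (f p)]
    (hf : ∀ p, p < Tn → f p < Tn) (hg : ∀ p, p < Tn → g p < Tn)
    (hgf : ∀ p, p < Tn → g (f p) = p) (hfg : ∀ p, p < Tn → f (g p) = p) :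
    ((Finset.range Tn).filter fun p => Q (f p)).card = ((Finset.range Tn).filter Q).card := by
  rw [Finset.card_filter, Finset.card_filter,
    ← sum_range_comp_eq (fun p => if Q p then 1 else 0) f g hf hg hgf hfg]
  apply Finset.sum_congr rfl
  intro p _
  by_cases h : Q (f p) <;> simp [h]

/-- A union bound for filters with an existential over `range m`. [folklore] -/
theorem card_filter_exists_range_le {Tn m : ℕ} (Q : ℕ → ℕ → Prop) [∀ i, DecidablePred (Q i)]
    [DecidablePred fun p => ∃ i, i < m ∧ Q i p] :
    ((Finset.range Tn).filter fun p => ∃ i, i < m ∧ Q i p).card ≤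
      ∑ i ∈ Finset.range m, ((Finset.range Tn).filter fun p => Q i p).card := by
  have hsub : ((Finset.range Tn).filter fun p => ∃ i, i < m ∧ Q i p) ⊆
      (Finset.range m).biUnion fun i => (Finset.range Tn).filter fun p => Q i p := by
    intro p hp
    rw [Finset.mem_filter] at hp
    obtain ⟨hp, i, hi, hQ⟩ := hp
    rw [Finset.mem_biUnion]
    exact ⟨i, Finset.mem_range.mpr hi, Finset.mem_filter.mpr ⟨hp, hQ⟩⟩
  exact (Finset.card_le_card hsub).trans Finset.card_biUnion_le

set_option maxHeartbeats 1600000 in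
/-- **The deterministic comb inequality (CW §4.7).** In a token structure over the cyclic word of
length `N = M n′` (consecutive, total length `N`, involution `P`), suppose every GOOD comb of
complexity `d` — all `2d+1` lengths `≤ ℓmax`, arc and blocks inside one period, and an abstract
regularity condition `R` — has length `≤ Lthr`. Then
`(2d+1) N ≤ Tn · Lthr + (bad combs) · (2d+1) ℓmax + (2d+1) Σ_{long} len`, where the number of bad
combs is at most `(2d+1)·#long + 4(d+1)·(N/n′) + #{p : ¬R p}`.
[cite: CalegariWalker2013, §4.7 and Lemma 4.12] -/
theorem token_comb_inequality {Tn N n' d ℓmax Lthr SB : ℕ} (hn' : 0 < n') (hNn : n' ∣ N)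
    (start len P : ℕ → ℕ) (hstart : ∀ p, p < Tn → start p < N)
    (hcons : ∀ p, p < Tn → start ((p + 1) % Tn) = (start p + len p) % N)
    (hP : ∀ p, p < Tn → P p < Tn ∧ P (P p) = p) (hlenP : ∀ p, p < Tn → len (P p) = len p)
    (hsum : ∑ p ∈ Finset.range Tn, len p = N) (R : ℕ → Prop)
    (hR : ((Finset.range Tn).filter fun p => ¬ R p).card ≤ SB)
    (hgood : ∀ p, p < Tn →
      (∀ i, i < d + 1 → len ((p + i) % Tn) ≤ ℓmax) →
      (∀ e, 1 ≤ e → e ≤ d → len ((P ((p + e) % Tn) + 1) % Tn) ≤ ℓmax) →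
      start p % n' + ∑ i ∈ Finset.range (d + 1), len ((p + i) % Tn) ≤ n' →
      (∀ i, i < d + 1 →
        start ((P ((p + i) % Tn) + Tn - 1) % Tn) % n' +
          (len ((P ((p + i) % Tn) + Tn - 1) % Tn) + len ((p + i) % Tn) +
            len ((P ((p + i) % Tn) + 1) % Tn)) ≤ n') →
      R p →
      (∑ i ∈ Finset.range (d + 1), len ((p + i) % Tn)) +
        ∑ e ∈ Finset.range (d + 2),
          (if 1 ≤ e ∧ e ≤ d then len ((P ((p + e) % Tn) + 1) % Tn) else 0) ≤ Lthr) :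
    (2 * d + 1) * N ≤ Tn * Lthr +
      ((2 * d + 1) * ((Finset.range Tn).filter fun p => ℓmax < len p).card + 4 * (d + 1) * (N / n') +
        SB) * ((2 * d + 1) * ℓmax) +
      (2 * d + 1) * ∑ p ∈ Finset.range Tn, (if ℓmax < len p then len p else 0) := by
  have hTn0 : ∀ p, p < Tn → 0 < Tn := fun p hp => by omega
  -- notation
  set Lf : ℕ → ℕ := fun p => (∑ i ∈ Finset.range (d + 1), len ((p + i) % Tn)) +
    ∑ e ∈ Finset.range (d + 2), (if 1 ≤ e ∧ e ≤ d then len ((P ((p + e) % Tn) + 1) % Tn) else 0)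
    with hLf
  set longp : ℕ → ℕ := fun p => (∑ i ∈ Finset.range (d + 1),
      (if ℓmax < len ((p + i) % Tn) then len ((p + i) % Tn) else 0)) +
    ∑ e ∈ Finset.range (d + 2), (if 1 ≤ e ∧ e ≤ d then
      (if ℓmax < len ((P ((p + e) % Tn) + 1) % Tn) then len ((P ((p + e) % Tn) + 1) % Tn) else 0)
        else 0) with hlongp
  set GOOD : ℕ → Prop := fun p =>
      (∀ i, i < d + 1 → len ((p + i) % Tn) ≤ ℓmax) ∧
      (∀ e, 1 ≤ e → e ≤ d → len ((P ((p + e) % Tn) + 1) % Tn) ≤ ℓmax) ∧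
      start p % n' + ∑ i ∈ Finset.range (d + 1), len ((p + i) % Tn) ≤ n' ∧
      (∀ i, i < d + 1 →
        start ((P ((p + i) % Tn) + Tn - 1) % Tn) % n' +
          (len ((P ((p + i) % Tn) + Tn - 1) % Tn) + len ((p + i) % Tn) +
            len ((P ((p + i) % Tn) + 1) % Tn)) ≤ n') ∧
      R p with hGOOD
  set LONG := ((Finset.range Tn).filter fun p => ℓmax < len p).card with hLONG
  set HIT : ℕ → Prop := fun T => ∃ j, j < len T ∧ (start T + j) % N % n' = n' - 1 with hHIT
  -- ### the total
  have htot : ∑ p ∈ Finset.range Tn, Lf p = (2 * d + 1) * N := sum_combLength_eq len P hP hsum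
  have hlong : ∑ p ∈ Finset.range Tn, longp p =
      (2 * d + 1) * ∑ p ∈ Finset.range Tn, (if ℓmax < len p then len p else 0) :=
    sum_combLength_long_eq len P hP
  -- ### per comb: `Lf p ≤ (2d+1) ℓmax + longp p`
  have hper : ∀ p, Lf p ≤ (2 * d + 1) * ℓmax + longp p := by
    intro p
    have h1 : ∀ x : ℕ, x ≤ ℓmax + (if ℓmax < x then x else 0) := by
      intro x; split_ifs <;> omega
    have hA : ∑ i ∈ Finset.range (d + 1), len ((p + i) % Tn) ≤
        (d + 1) * ℓmax + ∑ i ∈ Finset.range (d + 1),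
          (if ℓmax < len ((p + i) % Tn) then len ((p + i) % Tn) else 0) := by
      calc ∑ i ∈ Finset.range (d + 1), len ((p + i) % Tn)
          ≤ ∑ i ∈ Finset.range (d + 1), (ℓmax + (if ℓmax < len ((p + i) % Tn) then len ((p + i) % Tn) else 0)) :=
            Finset.sum_le_sum fun i _ => h1 _
        _ = _ := by rw [Finset.sum_add_distrib, Finset.sum_const, Finset.card_range, smul_eq_mul]
    have hK : ∑ e ∈ Finset.range (d + 2),
        (if 1 ≤ e ∧ e ≤ d then len ((P ((p + e) % Tn) + 1) % Tn) else 0) ≤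
        d * ℓmax + ∑ e ∈ Finset.range (d + 2), (if 1 ≤ e ∧ e ≤ d then
          (if ℓmax < len ((P ((p + e) % Tn) + 1) % Tn) then len ((P ((p + e) % Tn) + 1) % Tn) else 0)
            else 0) := by
      calc ∑ e ∈ Finset.range (d + 2), (if 1 ≤ e ∧ e ≤ d then len ((P ((p + e) % Tn) + 1) % Tn) else 0)
          ≤ ∑ e ∈ Finset.range (d + 2), ((if 1 ≤ e ∧ e ≤ d then ℓmax else 0) +
              (if 1 ≤ e ∧ e ≤ d then
                (if ℓmax < len ((P ((p + e) % Tn) + 1) % Tn) then len ((P ((p + e) % Tn) + 1) % Tn) else 0)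
              else 0)) := by
            apply Finset.sum_le_sum; intro e _
            split_ifs with h h' <;> omega
        _ = _ := by
            rw [Finset.sum_add_distrib]
            congr 1
            rw [Finset.sum_ite, Finset.sum_const_zero, add_zero, Finset.sum_const, smul_eq_mul]
            have : (Finset.range (d + 2)).filter (fun e => 1 ≤ e ∧ e ≤ d) = Finset.Icc 1 d := by
              ext e; simp [Finset.mem_filter, Finset.mem_Icc]; omega
            rw [this, Nat.card_Icc]
            have : d + 1 - 1 = d := by omega
            rw [this]
    simp only [hLf, hlongp]
    nlinarith [hA, hK]
  -- ### the bad combs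
  set BAD := (Finset.range Tn).filter fun p => ¬ GOOD p with hBAD
  have hBADcard : BAD.card ≤ (2 * d + 1) * LONG + 4 * (d + 1) * (N / n') + SB := by
    -- four reasons
    have hsub : BAD ⊆
        ((Finset.range Tn).filter fun p => ∃ i, i < d + 1 ∧ ℓmax < len ((p + i) % Tn)) ∪
        ((Finset.range Tn).filter fun p => ∃ e, e < d + 1 ∧ (1 ≤ e ∧ ℓmax < len ((P ((p + e) % Tn) + 1) % Tn))) ∪
        ((Finset.range Tn).filter fun p => ∃ i, i < d + 1 ∧ HIT ((p + i) % Tn)) ∪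
        ((Finset.range Tn).filter fun p => ∃ i, i < d + 1 ∧
          (HIT ((P ((p + i) % Tn) + Tn - 1) % Tn) ∨ HIT (P ((p + i) % Tn)) ∨
            HIT ((P ((p + i) % Tn) + 1) % Tn))) ∪
        ((Finset.range Tn).filter fun p => ¬ R p) := by
      intro p hp
      rw [hBAD, Finset.mem_filter, Finset.mem_range] at hp
      obtain ⟨hpT, hng⟩ := hp
      simp only [Finset.mem_union, Finset.mem_filter, Finset.mem_range]
      by_cases hA : ∃ i, i < d + 1 ∧ ℓmax < len ((p + i) % Tn)
      · exact Or.inl (Or.inl (Or.inl (Or.inl ⟨hpT, hA⟩)))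
      by_cases hK : ∃ e, e < d + 1 ∧ (1 ≤ e ∧ ℓmax < len ((P ((p + e) % Tn) + 1) % Tn))
      · exact Or.inl (Or.inl (Or.inl (Or.inr ⟨hpT, hK⟩)))
      by_cases hW : ∃ i, i < d + 1 ∧ HIT ((p + i) % Tn)
      · exact Or.inl (Or.inl (Or.inr ⟨hpT, hW⟩))
      by_cases hWB : ∃ i, i < d + 1 ∧
          (HIT ((P ((p + i) % Tn) + Tn - 1) % Tn) ∨ HIT (P ((p + i) % Tn)) ∨
            HIT ((P ((p + i) % Tn) + 1) % Tn))
      · exact Or.inl (Or.inr ⟨hpT, hWB⟩)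
      by_cases hRp : ¬ R p
      · exact Or.inr ⟨hpT, hRp⟩
      exfalso
      apply hng
      refine ⟨?_, ?_, ?_, ?_, ?_⟩
      · intro i hi; by_contra h; exact hA ⟨i, hi, Nat.lt_of_not_le h⟩
      · intro e he1 hed; by_contra h; exact hK ⟨e, by omega, he1, Nat.lt_of_not_le h⟩
      · by_contra h
        obtain ⟨i, hi, hh⟩ := hit_of_arc_wrap hn' hNn start len hstart hcons p hpT (Nat.lt_of_not_le h)
        exact hW ⟨i, hi, hh⟩
      · intro i hi; by_contra h
        have hq : (p + i) % Tn < Tn := Nat.mod_lt _ (hTn0 p hpT)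
        have hx : P ((p + i) % Tn) < Tn := (hP _ hq).1
        have h' : n' < start ((P ((p + i) % Tn) + Tn - 1) % Tn) % n' +
            (len ((P ((p + i) % Tn) + Tn - 1) % Tn) + len (P ((p + i) % Tn)) +
              len ((P ((p + i) % Tn) + 1) % Tn)) := by
          rw [hlenP _ hq]; exact Nat.lt_of_not_le h
        have hh := hit_of_block_wrap hn' hNn start len hcons (P ((p + i) % Tn)) hx h'
        exact hWB ⟨i, hi, hh⟩
      · by_contra h; exact hRp h
    refine (Finset.card_le_card hsub).trans ?_
    refine (Finset.card_union_le _ _).trans ?_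
    refine (Nat.add_le_add_right (Finset.card_union_le _ _) _).trans ?_
    refine (Nat.add_le_add_right (Nat.add_le_add_right (Finset.card_union_le _ _) _) _).trans ?_
    refine (Nat.add_le_add_right (Nat.add_le_add_right (Nat.add_le_add_right
      (Finset.card_union_le _ _) _) _) _).trans ?_
    -- bound each piece
    have hT0 : ∀ {p}, p < Tn → 0 < Tn := fun hp => by omega
    -- (1) long arc tokens
    have c1 : ((Finset.range Tn).filter fun p => ∃ i, i < d + 1 ∧ ℓmax < len ((p + i) % Tn)).card ≤
        (d + 1) * LONG := by
      refine (card_filter_exists_range_le (Tn := Tn) (m := d + 1) (fun i p => ℓmax < len ((p + i) % Tn))).trans ?_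
      have : ∀ i ∈ Finset.range (d + 1),
          ((Finset.range Tn).filter fun p => ℓmax < len ((p + i) % Tn)).card = LONG := by
        intro i _
        rw [hLONG, Finset.card_filter, Finset.card_filter]
        exact sum_range_shift_eq (fun p => if ℓmax < len p then 1 else 0) i
      rw [Finset.sum_congr rfl this, Finset.sum_const, Finset.card_range, smul_eq_mul]
    -- (2) long third edges
    have c2 : ((Finset.range Tn).filter fun p => ∃ e, e < d + 1 ∧
        (1 ≤ e ∧ ℓmax < len ((P ((p + e) % Tn) + 1) % Tn))).card ≤ d * LONG := by
      refine (card_filter_exists_range_le (Tn := Tn) (m := d + 1)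
        (fun e p => 1 ≤ e ∧ ℓmax < len ((P ((p + e) % Tn) + 1) % Tn))).trans ?_
      have : ∀ e ∈ Finset.range (d + 1), ((Finset.range Tn).filter fun p =>
          1 ≤ e ∧ ℓmax < len ((P ((p + e) % Tn) + 1) % Tn)).card ≤ LONG := by
        intro e _
        by_cases he : 1 ≤ e
        · have : ((Finset.range Tn).filter fun p =>
              1 ≤ e ∧ ℓmax < len ((P ((p + e) % Tn) + 1) % Tn)).card =
              ((Finset.range Tn).filter fun p => ℓmax < len ((P ((p + e) % Tn) + 1) % Tn)).card := by
            congr 1; ext p; simp [he]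
          rw [this, hLONG, Finset.card_filter, Finset.card_filter,
            sum_range_shift_eq (fun x => if ℓmax < len ((P x + 1) % Tn) then 1 else 0) e,
            sum_range_invol_eq (fun x => if ℓmax < len ((x + 1) % Tn) then 1 else 0) P hP,
            sum_range_shift_eq (fun x => if ℓmax < len x then 1 else 0) 1]
        · have : ((Finset.range Tn).filter fun p =>
              1 ≤ e ∧ ℓmax < len ((P ((p + e) % Tn) + 1) % Tn)) = ∅ := by
            rw [Finset.filter_eq_empty_iff]; intro p _ h; exact he h.1
          rw [this, Finset.card_empty]; exact Nat.zero_le _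
      have h0 : ((Finset.range Tn).filter fun p =>
          1 ≤ 0 ∧ ℓmax < len ((P ((p + 0) % Tn) + 1) % Tn)).card = 0 := by
        rw [Finset.card_eq_zero, Finset.filter_eq_empty_iff]; intro p _ h; omega
      rw [Finset.sum_range_succ', h0, add_zero]
      calc _ ≤ ∑ e ∈ Finset.range d, LONG := Finset.sum_le_sum fun e he => this (e + 1) (by
              rw [Finset.mem_range] at he ⊢; omega)
        _ = d * LONG := by rw [Finset.sum_const, Finset.card_range, smul_eq_mul]
    -- the hit count
    have hHITc : ((Finset.range Tn).filter HIT).card ≤ N / n' :=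
      card_filter_hit_le hn' hNn start len hstart hcons hsum
    -- (3) wrapping arcs
    have c3 : ((Finset.range Tn).filter fun p => ∃ i, i < d + 1 ∧ HIT ((p + i) % Tn)).card ≤
        (d + 1) * (N / n') := by
      refine (card_filter_exists_range_le (Tn := Tn) (m := d + 1) (fun i p => HIT ((p + i) % Tn))).trans ?_
      have : ∀ i ∈ Finset.range (d + 1),
          ((Finset.range Tn).filter fun p => HIT ((p + i) % Tn)).card ≤ N / n' := by
        intro i _
        rw [Finset.card_filter, sum_range_shift_eq (fun p => if HIT p then 1 else 0) i,
          ← Finset.card_filter]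
        exact hHITc
      calc _ ≤ ∑ i ∈ Finset.range (d + 1), N / n' := Finset.sum_le_sum this
        _ = (d + 1) * (N / n') := by rw [Finset.sum_const, Finset.card_range, smul_eq_mul]
    -- (4) wrapping blocks
    have hshiftP : ∀ (i : ℕ) (Q : ℕ → Prop) [DecidablePred Q]
        [DecidablePred fun p => Q (P ((p + i) % Tn))],
        ((Finset.range Tn).filter fun p => Q (P ((p + i) % Tn))).card =
          ((Finset.range Tn).filter Q).card := by
      intro i Q _ _
      rw [Finset.card_filter, Finset.card_filter]
      have h1 := sum_range_shift_eq (Tn := Tn) (fun x => if Q (P x) then 1 else 0) i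
      have h2 := sum_range_invol_eq (fun x => if Q x then 1 else 0) P hP
      rw [← h2, ← h1]
      apply Finset.sum_congr rfl
      intro p _
      by_cases h : Q (P ((p + i) % Tn)) <;> simp [h]
    have c4 : ((Finset.range Tn).filter fun p => ∃ i, i < d + 1 ∧
        (HIT ((P ((p + i) % Tn) + Tn - 1) % Tn) ∨ HIT (P ((p + i) % Tn)) ∨
          HIT ((P ((p + i) % Tn) + 1) % Tn))).card ≤ 3 * (d + 1) * (N / n') := by
      refine (card_filter_exists_range_le (Tn := Tn) (m := d + 1) (fun i p =>
        (HIT ((P ((p + i) % Tn) + Tn - 1) % Tn) ∨ HIT (P ((p + i) % Tn)) ∨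
          HIT ((P ((p + i) % Tn) + 1) % Tn)))).trans ?_
      have : ∀ i ∈ Finset.range (d + 1), ((Finset.range Tn).filter fun p =>
          (HIT ((P ((p + i) % Tn) + Tn - 1) % Tn) ∨ HIT (P ((p + i) % Tn)) ∨
            HIT ((P ((p + i) % Tn) + 1) % Tn))).card ≤ 3 * (N / n') := by
        intro i _
        have hsub3 : ((Finset.range Tn).filter fun p =>
            (HIT ((P ((p + i) % Tn) + Tn - 1) % Tn) ∨ HIT (P ((p + i) % Tn)) ∨
              HIT ((P ((p + i) % Tn) + 1) % Tn))) ⊆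
            ((Finset.range Tn).filter fun p => HIT ((P ((p + i) % Tn) + Tn - 1) % Tn)) ∪
            ((Finset.range Tn).filter fun p => HIT (P ((p + i) % Tn))) ∪
            ((Finset.range Tn).filter fun p => HIT ((P ((p + i) % Tn) + 1) % Tn)) := by
          intro p hp
          rw [Finset.mem_filter] at hp
          simp only [Finset.mem_union, Finset.mem_filter]
          obtain ⟨hp1, h | h | h⟩ := hp
          · exact Or.inl (Or.inl ⟨hp1, h⟩)
          · exact Or.inl (Or.inr ⟨hp1, h⟩)
          · exact Or.inr ⟨hp1, h⟩
        refine (Finset.card_le_card hsub3).trans ?_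
        refine (Finset.card_union_le _ _).trans ?_
        refine (Nat.add_le_add_right (Finset.card_union_le _ _) _).trans ?_
        -- each of the three is `≤ N / n'`
        have e1 : ((Finset.range Tn).filter fun p => HIT ((P ((p + i) % Tn) + Tn - 1) % Tn)).card ≤ N / n' := by
          rw [hshiftP i (fun x => HIT ((x + Tn - 1) % Tn)),
            card_filter_comp_eq HIT (fun x => (x + Tn - 1) % Tn) (fun x => (x + 1) % Tn)
              (fun x hx => Nat.mod_lt _ (by omega)) (fun x hx => Nat.mod_lt _ (by omega))
              (fun x hx => succ_pred_mod x hx) (fun x hx => pred_succ_mod x hx)]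
          exact hHITc
        have e2 : ((Finset.range Tn).filter fun p => HIT (P ((p + i) % Tn))).card ≤ N / n' := by
          rw [hshiftP i HIT]; exact hHITc
        have e3 : ((Finset.range Tn).filter fun p => HIT ((P ((p + i) % Tn) + 1) % Tn)).card ≤ N / n' := by
          rw [hshiftP i (fun x => HIT ((x + 1) % Tn)), Finset.card_filter,
            sum_range_shift_eq (fun x => if HIT x then 1 else 0) 1, ← Finset.card_filter]
          exact hHITc
        omega
      calc _ ≤ ∑ i ∈ Finset.range (d + 1), 3 * (N / n') := Finset.sum_le_sum this
        _ = 3 * (d + 1) * (N / n') := by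
            rw [Finset.sum_const, Finset.card_range, smul_eq_mul]; ring
    have h5 := hR
    have e1 : (d + 1) * LONG + d * LONG = (2 * d + 1) * LONG := by ring
    have e2 : (d + 1) * (N / n') + 3 * (d + 1) * (N / n') = 4 * (d + 1) * (N / n') := by ring
    omega
  -- ### assemble
  have hsplit := Finset.sum_filter_add_sum_filter_not (Finset.range Tn) GOOD Lf
  have hG : ∑ p ∈ (Finset.range Tn).filter GOOD, Lf p ≤ Tn * Lthr := by
    calc ∑ p ∈ (Finset.range Tn).filter GOOD, Lf p ≤ ∑ p ∈ (Finset.range Tn).filter GOOD, Lthr := by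
          apply Finset.sum_le_sum
          intro p hp
          rw [Finset.mem_filter, Finset.mem_range] at hp
          obtain ⟨hpT, h1, h2, h3, h4, h5⟩ := hp
          exact hgood p hpT h1 h2 h3 h4 h5
      _ = ((Finset.range Tn).filter GOOD).card * Lthr := by
          rw [Finset.sum_const, smul_eq_mul]
      _ ≤ Tn * Lthr := by
          apply Nat.mul_le_mul_right
          calc ((Finset.range Tn).filter GOOD).card ≤ (Finset.range Tn).card := Finset.card_filter_le _ _
            _ = Tn := Finset.card_range _
  have hB : ∑ p ∈ BAD, Lf p ≤ BAD.card * ((2 * d + 1) * ℓmax) + ∑ p ∈ Finset.range Tn, longp p := by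
    calc ∑ p ∈ BAD, Lf p ≤ ∑ p ∈ BAD, ((2 * d + 1) * ℓmax + longp p) :=
          Finset.sum_le_sum fun p _ => hper p
      _ = BAD.card * ((2 * d + 1) * ℓmax) + ∑ p ∈ BAD, longp p := by
          rw [Finset.sum_add_distrib, Finset.sum_const, smul_eq_mul]
      _ ≤ BAD.card * ((2 * d + 1) * ℓmax) + ∑ p ∈ Finset.range Tn, longp p := by
          apply Nat.add_le_add_left
          exact Finset.sum_le_sum_of_subset (Finset.filter_subset _ _)
  rw [← htot, ← hsplit, ← hlong]
  have hmul : BAD.card * ((2 * d + 1) * ℓmax) ≤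
      ((2 * d + 1) * LONG + 4 * (d + 1) * (N / n') + SB) * ((2 * d + 1) * ℓmax) :=
    Nat.mul_le_mul_right _ hBADcard
  set SG := ∑ p ∈ (Finset.range Tn).filter GOOD, Lf p with hSG
  set SBd := ∑ p ∈ BAD, Lf p with hSBd
  omega

end TokenAveraging

end Literature.GroupTheory.CombinatorialGroupTheory

end
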